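import Mathlib
import Summits.NavierStokesRegularity.NavierStokesRegularity.Theorems.FilamentSkeletonRssClause13ModelPieceWindow

/-!
# Clause 13-J/13-R, brick n3 (SUP OF A PIECE, model step m3a): `‖P(x)‖² ≤ N(P)·N(P′)` and `sup|k∗Y| ≤ √(‖k‖₁‖k′‖₁)·N(Y)`

Route `FilamentSkeletonRss`, ∃-side clause 13 (`Clause13RNearStraightL` stmt-NavierStokesRegularity-23612; typing-agnostic); design
`filament-plan/DESIGN-28296-model-L2closed-and-Linfty-g17.md` §3–§4 (m3a).  The model estimate (`model_l2_estimate(_closed)`, p709153 / p710825) is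
in `L²`; clause 13 concludes with sup norms.  For the spectrally bounded pieces the passage is the one-dimensional Agmon inequality combined with
"the derivative of a piece sits on the kernel" (`piece_deriv_eq_derivKernel_piece`, p701338):
* §1 `normSq_le_l2_mul_l2_deriv` — for `P ∈ C¹` with `P, P′ ∈ L²`: `‖P(x)‖² ≤ N(P)·N(P′)` for every `x` (`N(f) = (∫‖f‖²)^{1/2}`; FTC on both half
  lines, `‖P‖² → 0` at `±∞` because `‖P‖²` and its derivative are integrable);
* §2 `norm_piece_le_sqrt_mul_l2` — for `P = k∗Y` (`k` real `C¹`, `k, k′ ∈ L¹`, `Y ∈ C¹_c`): `‖P(x)‖ ≤ √(‖k‖₁‖k′‖₁)·N(Y)`.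
(The far piece `Y − k_N∗Y` is NOT covered: its sup near the waist is the open design point of the memo.)
Lane ns-filament-19175-p1 g17; `--supports stmt-NavierStokesRegularity-23612 --as helper`.
HONEST FRAMING: bookkeeping about an explicit 1-D model operator attached to a HYPOTHETICAL filament skeleton on the NEGATIVE side of a MODEL route;
nothing here bears on Navier–Stokes regularity or blow-up.
-/

noncomputable section

open MeasureTheory Real Complex Filter Set
open scoped ComplexConjugate Topology

namespace Summit.NavierStokesRegularity.NavierStokesRegularity.Theorems.MatchedKernel
set_option linter.dupNamespace false

/-! ## §1 Agmon's inequality on the line -/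

/-- The real function `x ↦ ‖P x‖²` has derivative `2(Re P′·Re P + Im P′·Im P)`. [folklore] -/
theorem hasDerivAt_normSq_comp {P : ℝ → ℂ} {P' : ℂ} {x : ℝ} (h : HasDerivAt P P' x) :
    HasDerivAt (fun t : ℝ => ‖P t‖ ^ 2) (2 * (P'.re * (P x).re + P'.im * (P x).im)) x := by
  have hre := hasDerivAt_re_comp h
  have him := hasDerivAt_im_comp h
  have e : (fun t : ℝ => ‖P t‖ ^ 2) = fun t => (P t).re ^ 2 + (P t).im ^ 2 := by
    funext t; rw [Complex.sq_norm, Complex.normSq_apply]; ring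
  rw [e]
  have h2 := ((hre.pow 2).add (him.pow 2))
  refine h2.congr_deriv ?_
  simp only [Nat.cast_ofNat]
  ring

/-- **AGMON (1-D)**: `P ∈ C¹` with `P, P′ ∈ L²` ⟹ `‖P(x)‖² ≤ N(P)·N(P′)` for every `x`. [folklore] -/
theorem normSq_le_l2_mul_l2_deriv {P P' : ℝ → ℂ} (hP : ∀ t, HasDerivAt P (P' t) t) (hP'c : Continuous P') (hP2 : MemLp P 2 volume)
    (hP'2 : MemLp P' 2 volume) (x : ℝ) :
    ‖P x‖ ^ 2 ≤ (∫ t, ‖P t‖ ^ 2) ^ (1 / 2 : ℝ) * (∫ t, ‖P' t‖ ^ 2) ^ (1 / 2 : ℝ) := by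
  have hPc : Continuous P := continuous_iff_continuousAt.2 fun t => (hP t).continuousAt
  -- `g = ‖P‖²` and its derivative
  set g : ℝ → ℝ := fun t => ‖P t‖ ^ 2 with hg
  set g' : ℝ → ℝ := fun t => 2 * ((P' t).re * (P t).re + (P' t).im * (P t).im) with hg'
  have hgd : ∀ t, HasDerivAt g (g' t) t := fun t => hasDerivAt_normSq_comp (hP t)
  have hgi : Integrable g := (memLp_two_iff_integrable_sq_norm hP2.1).1 hP2
  -- `|g′| ≤ 2‖P′‖‖P‖`, integrable
  have hprod : Integrable fun t : ℝ => ‖P' t‖ * ‖P t‖ := hP'2.norm.integrable_mul hP2.norm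
  have hg'le : ∀ t, |g' t| ≤ 2 * (‖P' t‖ * ‖P t‖) := by
    intro t
    have h1 : |(P' t).re * (P t).re + (P' t).im * (P t).im| ≤ ‖P' t‖ * ‖P t‖ := by
      have hre1 := Complex.abs_re_le_norm (P' t)
      have him1 := Complex.abs_im_le_norm (P' t)
      have hre2 := Complex.abs_re_le_norm (P t)
      have him2 := Complex.abs_im_le_norm (P t)
      -- Cauchy–Schwarz in `ℝ²`
      rw [abs_le]
      have hn1 : ‖P' t‖ ^ 2 = (P' t).re ^ 2 + (P' t).im ^ 2 := by rw [Complex.sq_norm, Complex.normSq_apply]; ring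
      have hn2 : ‖P t‖ ^ 2 = (P t).re ^ 2 + (P t).im ^ 2 := by rw [Complex.sq_norm, Complex.normSq_apply]; ring
      have h0 : 0 ≤ ‖P' t‖ * ‖P t‖ := by positivity
      have key : ((P' t).re * (P t).re + (P' t).im * (P t).im) ^ 2 ≤ (‖P' t‖ * ‖P t‖) ^ 2 := by
        rw [mul_pow, hn1, hn2]
        nlinarith [sq_nonneg ((P' t).re * (P t).im - (P' t).im * (P t).re)]
      constructor
      · nlinarith [key, h0]
      · nlinarith [key, h0]
    rw [hg', abs_mul, abs_two]
    linarith
  have hg'i : Integrable g' := by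
    refine (hprod.const_mul 2).mono' ((continuous_const.mul (((Complex.continuous_re.comp hP'c).mul (Complex.continuous_re.comp hPc)).add
      ((Complex.continuous_im.comp hP'c).mul (Complex.continuous_im.comp hPc)))).aestronglyMeasurable) (ae_of_all _ fun t => ?_)
    rw [Real.norm_eq_abs]; exact hg'le t
  -- limits at `±∞`
  have hbot : Tendsto g atBot (𝓝 0) :=
    tendsto_zero_of_hasDerivAt_of_integrableOn_Iic (a := x) (fun t _ => hgd t) hg'i.integrableOn hgi.integrableOn
  have htop : Tendsto g atTop (𝓝 0) :=
    tendsto_zero_of_hasDerivAt_of_integrableOn_Ioi (a := x) (fun t _ => hgd t) hg'i.integrableOn hgi.integrableOn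
  -- FTC on both half lines
  have h1 : ∫ t in Iic x, g' t = g x - 0 := integral_Iic_of_hasDerivAt_of_tendsto' (fun t _ => hgd t) hg'i.integrableOn hbot
  have h2 : ∫ t in Ioi x, g' t = 0 - g x := integral_Ioi_of_hasDerivAt_of_tendsto' (fun t _ => hgd t) hg'i.integrableOn htop
  have hsplit : ∫ t, |g' t| = (∫ t in Iic x, |g' t|) + ∫ t in Ioi x, |g' t| :=
    (intervalIntegral.integral_Iic_add_Ioi hg'i.abs.integrableOn hg'i.abs.integrableOn).symm
  have hA : g x ≤ ∫ t in Iic x, |g' t| := by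
    have := norm_integral_le_integral_norm (μ := volume.restrict (Iic x)) g'
    rw [h1, sub_zero, Real.norm_eq_abs] at this
    simp only [Real.norm_eq_abs] at this
    exact (le_abs_self _).trans this
  have hB : g x ≤ ∫ t in Ioi x, |g' t| := by
    have := norm_integral_le_integral_norm (μ := volume.restrict (Ioi x)) g'
    rw [h2, zero_sub, norm_neg, Real.norm_eq_abs] at this
    simp only [Real.norm_eq_abs] at this
    exact (le_abs_self _).trans this
  have h2g : 2 * g x ≤ ∫ t, |g' t| := by rw [hsplit]; linarith
  have hint : ∫ t, |g' t| ≤ 2 * ∫ t, ‖P' t‖ * ‖P t‖ := by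
    rw [← integral_const_mul]
    exact integral_mono_of_nonneg (ae_of_all _ fun t => abs_nonneg _) (hprod.const_mul 2) (ae_of_all _ hg'le)
  have hcs := integral_norm_mul_norm_le hP'2 hP2
  have hgx : g x = ‖P x‖ ^ 2 := rfl
  rw [← hgx]
  nlinarith [hcs, h2g, hint, mul_comm ((∫ t, ‖P' t‖ ^ 2) ^ (1 / 2 : ℝ)) ((∫ t, ‖P t‖ ^ 2) ^ (1 / 2 : ℝ))]

/-! ## §2 The sup of a cut-off piece -/

/-- **`‖(k∗Y)(x)‖ ≤ √(‖k‖₁‖k′‖₁)·N(Y)`** for `k` real `C¹` with `k, k′ ∈ L¹` (continuous `k′`) and `Y ∈ C¹_c`. [folklore] -/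
theorem norm_piece_le_sqrt_mul_l2 {k k' : ℝ → ℝ} (hk : ∀ t, HasDerivAt k (k' t) t) (hk'c : Continuous k') (hki : Integrable k)
    (hk'i : Integrable k') {Y : ℝ → ℂ} (hY : ContDiff ℝ 1 Y) (hYs : HasCompactSupport Y) (x : ℝ) :
    ‖∫ y : ℝ, ((k (x - y) : ℝ) : ℂ) * Y y‖ ≤ Real.sqrt ((∫ t, |k t|) * ∫ t, |k' t|) * (∫ y : ℝ, ‖Y y‖ ^ 2) ^ (1 / 2 : ℝ) := by
  have hkc : Continuous k := continuous_iff_continuousAt.2 fun t => (hk t).continuousAt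
  have hYc := hY.continuous
  -- the piece and its derivative (which sits on the kernel)
  have hPd : ∀ t : ℝ, HasDerivAt (fun x : ℝ => ∫ y : ℝ, ((k (x - y) : ℝ) : ℂ) * Y y) (∫ y : ℝ, ((k' (t - y) : ℝ) : ℂ) * Y y) t := by
    intro t
    have h := hasDerivAt_piece hkc hY hYs t
    rw [piece_deriv_eq_derivKernel_piece hk hk'c hY hYs t] at h
    exact h
  have hP'c : Continuous fun x : ℝ => ∫ y : ℝ, ((k' (x - y) : ℝ) : ℂ) * Y y := continuous_piece hk'c hYc hYs
  obtain ⟨hP2, hPle⟩ := integral_sq_norm_piece_le hkc hki hYc hYs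
  obtain ⟨hP'2, hP'le⟩ := integral_sq_norm_piece_le hk'c hk'i hYc hYs
  have hag := normSq_le_l2_mul_l2_deriv hPd hP'c hP2 hP'2 x
  have hK0 : 0 ≤ ∫ t, |k t| := integral_nonneg fun t => abs_nonneg _
  have hK'0 : 0 ≤ ∫ t, |k' t| := integral_nonneg fun t => abs_nonneg _
  have hNP := l2_le_of_sq_le hK0 hPle
  have hNP' := l2_le_of_sq_le hK'0 hP'le
  have hNY : 0 ≤ (∫ y : ℝ, ‖Y y‖ ^ 2) ^ (1 / 2 : ℝ) := by positivity
  have hsq : ‖∫ y : ℝ, ((k (x - y) : ℝ) : ℂ) * Y y‖ ^ 2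
      ≤ (Real.sqrt ((∫ t, |k t|) * ∫ t, |k' t|) * (∫ y : ℝ, ‖Y y‖ ^ 2) ^ (1 / 2 : ℝ)) ^ 2 := by
    rw [mul_pow, Real.sq_sqrt (mul_nonneg hK0 hK'0)]
    have h0 : 0 ≤ (∫ x : ℝ, ‖∫ y : ℝ, ((k (x - y) : ℝ) : ℂ) * Y y‖ ^ 2) ^ (1 / 2 : ℝ) := by positivity
    calc ‖∫ y : ℝ, ((k (x - y) : ℝ) : ℂ) * Y y‖ ^ 2 ≤ _ := hag
      _ ≤ ((∫ t, |k t|) * (∫ y : ℝ, ‖Y y‖ ^ 2) ^ (1 / 2 : ℝ)) * ((∫ t, |k' t|) * (∫ y : ℝ, ‖Y y‖ ^ 2) ^ (1 / 2 : ℝ)) :=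
          mul_le_mul hNP hNP' (by positivity) (by positivity)
      _ = (∫ t, |k t|) * (∫ t, |k' t|) * ((∫ y : ℝ, ‖Y y‖ ^ 2) ^ (1 / 2 : ℝ)) ^ 2 := by ring
  exact (pow_le_pow_iff_left₀ (norm_nonneg _) (by positivity) two_ne_zero).1 hsq

end Summit.NavierStokesRegularity.NavierStokesRegularity.Theorems.MatchedKernel

end
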